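import Literature.AnabelianGeometry.EtaleTheta.ThetaCoversTempered
import Literature.AnabelianGeometry.EtaleTheta.Discharge.Sec2DiscreteNormalizersOfHall
import Literature.AnabelianGeometry.EtaleTheta.Discharge.Sec2DiscreteNormalizersTempered

/-!
# [EtTh] Lemma 2.17 (i), (ii): bridges to the typed statements `TemperedCoverData.Lem217_i/_ii`

Mochizuki, *The Étale Theta Function and its Frobenioid-theoretic Manifestations* [EtTh],
Publ. RIMS 45 (2009), §2, Lemma 2.17, PRIMS text pp.58–59 (printed pp.284–285; bib key
`MochizukiEtTh2009`).  PROOF-ONLY (no definitions): the typed statements of abc-iut-L2-t2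
(`ThetaCoversTempered.lean`) are obtained BY NAME from the discharge files
`Discharge/Sec2DiscreteNormalizers*.lean`:

* `TemperedCoverData.Lem217_i_of_hall` — Lemma 2.17 (i) (`Lem217_i`) modulo its printed input
  (a) [SemiAnbd] Cor. 1.6 (ii) (`SemiGraphs.corollary_1_6_ii`, tree FACT, being discharged by
  abc-iut-L5-t16); inputs (b) "Stebe" and (c) "centralizers of free generators" are the tree theorems
  `FreeGroup.conjugacySeparable` (abc-iut-L5-t14) / `ProfiniteCompletion.centralizer_eta_basis_le_closure_zpowers`
  (abc-iut-L5-d2);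
* `TemperedCoverData.Lem217_ii_of` — Lemma 2.17 (ii) (`T.Lem217_ii`) for a `T : TemperedCoverData l`
  from the same input plus: `Π^tp_C` is tempered (`SemiGraphs.IsTempered T.Gtp`, [SemiAnbd]
  Def. 3.1 (i)) and the ANABELIAN input `htower` — every open `H ⊆ Π^tp_C` contains cofinally many
  open normal `N` with `Π^tp_C/N` "contain[ing a] finite rank free normal subgroup of finite index"
  (p.59) meeting `H/N` non-abelianly ([André]'s structure of tempered fundamental groups of
  hyperbolic curves; abc-iut FOUNDATIONS rows 13–14) — using the interface field
  `T.isProfiniteCompletion_toHat` (L2-lead ruling 2026-08-25T19:56Z).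

* `TemperedCoverData.Rmk2162_of` — Remark 2.16.2's normaliser identity in a dischargeable restated
  form (interface keeps it as doc; abc-iut-L2-t2 20:35Z), from `T.Lem217_ii` and the arithmetic
  antecedent `harith`.

Honest framing: nothing here concerns [IUTchIII] Cor. 3.12; typed ≠ discharged — the items are
discharged MODULO the named inputs listed in their hypotheses.
-/

namespace Literature.AnabelianGeometry.EtaleTheta.ThetaCovers.TemperedCoverData

open CategoryTheory Topology Literature.AnabelianGeometry.EtaleTheta.DiscreteNormalizers

universe u

/-- **[EtTh] Lemma 2.17 (i)** as typed (`Lem217_i`), modulo the printed input (a) `hHall` =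
[SemiAnbd] Cor. 1.6 (ii); (b) Stebe and (c) centralizers of free generators are the tree theorems
`FreeGroup.conjugacySeparable` / `ProfiniteCompletion.centralizer_eta_basis_le_closure_zpowers`.
[cite: MochizukiEtTh2009, Lem 2.17(i) pp.58–59] -/
theorem Lem217_i_of_hall (hHall : SemiGraphs.corollary_1_6_ii.{u}) : Lem217_i.{u} :=
  lem217_i_of_hall hHall

/-- **[EtTh] Lemma 2.17 (ii)** as typed (`T.Lem217_ii`) for `T : TemperedCoverData l`, from Lemma
2.17 (i)'s input (a) `hHall`, the temperedness of `Π^tp_C` (`hT`, [SemiAnbd] Def. 3.1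
(i)) and the anabelian tower input `htower` ("quotients of `Π` by characteristic open subgroups of
`Π`, which contain finite rank free normal subgroups of finite index", p.59), via the interface field
`T.isProfiniteCompletion_toHat` and the inverse-limit argument `normalizer_map_eq_of_isTempered`.
[cite: MochizukiEtTh2009, Lem 2.17(ii) pp.58–59] -/
theorem Lem217_ii_of {l : ℕ} (T : TemperedCoverData.{u} l)
    (hHall : SemiGraphs.corollary_1_6_ii.{u}) (hT : SemiGraphs.IsTempered T.Gtp)
    (htower : ∀ H : Subgroup T.Gtp, IsOpen (H : Set T.Gtp) → ∀ U ∈ 𝓝 (1 : T.Gtp),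
      ∃ N : OpenNormalSubgroup T.Gtp, (N : Set T.Gtp) ⊆ U ∧ N.toSubgroup ≤ H ∧
        ∃ (G : Subgroup (T.Gtp ⧸ N.toSubgroup)) (_ : IsFreeGroup G), G.Normal ∧ G.FiniteIndex ∧
          Finite (IsFreeGroup.Generators G) ∧
          ∃ a ∈ H.map (QuotientGroup.mk' N.toSubgroup) ⊓ G,
            ∃ b ∈ H.map (QuotientGroup.mk' N.toSubgroup) ⊓ G, a * b ≠ b * a) :
    T.Lem217_ii := by
  intro H hH
  exact normalizer_map_eq_of_isTempered (lem217_i_of_hall hHall) hT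
    ⟨T.toHat, T.continuous_toHat⟩ T.isProfiniteCompletion_toHat H (htower H hH)

/-- **[EtTh] Remark 2.16.2** (p.57), the one mathematical claim, in a DISCHARGEABLE restated form
(the interface file keeps Rmk 2.16.2 as a doc paragraph; abc-iut-L2-t2 2026-08-25T20:35Z asked for the
restated decl to live here).  Printed: for `X = X_F ×_F F_v` and `H ⊆ Π^tp_X` open, "the two
normalizers in question in fact coincide — i.e., we have `N_{Π^tp_X}(H) = N_{Π_{X_F}}(Im(H))` [by
Lemma 2.17, (ii); the well-known fact that `G_{F_v}` is its own normalizer in `G_F`]".  Here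
`Π^tp_X = T.tp T.PiX ⊆ Π^tp_C`, `Π_X = T.PiX ⊆ Π_C`, `j : Π_X ↪ Π_{X_F}` is an abstract injection, and
the arithmetic input is the antecedent `harith`: an element of `Π_{X_F}` normalising the image of an
OPEN subgroup of `Π^tp_X` already lies in `Π_X` (in print: `Π_X = Π_{X_F} ×_{G_F} G_{F_v}` and the
normal terminality of `G_{F_v}` in `G_F` applied to the image of `H` in `G_{F_v}`).  From `T.Lem217_ii`.
[cite: MochizukiEtTh2009, Rmk 2.16.2 p.57] -/
theorem Rmk2162_of {l : ℕ} (T : TemperedCoverData.{u} l) (h217ii : T.Lem217_ii)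
    {PiXF : Type u} [Group PiXF] (j : ↥T.PiX →* PiXF) (hj : Function.Injective j)
    (harith : ∀ U : Subgroup ↥(T.tp T.PiX), IsOpen (U : Set ↥(T.tp T.PiX)) → ∀ a : PiXF,
      a ∈ Subgroup.normalizer
        (((U.map ((T.toHat.comp (T.tp T.PiX).subtype).codRestrict T.PiX fun x => x.2)).map j :
          Subgroup PiXF) : Set PiXF) → a ∈ j.range)
    (H : Subgroup ↥(T.tp T.PiX)) (hH : IsOpen (H : Set ↥(T.tp T.PiX))) :
    let φ : ↥(T.tp T.PiX) →* PiXF :=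
      j.comp ((T.toHat.comp (T.tp T.PiX).subtype).codRestrict T.PiX fun x => x.2)
    Subgroup.normalizer ((H.map φ : Subgroup PiXF) : Set PiXF) =
      (Subgroup.normalizer (H : Set ↥(T.tp T.PiX))).map φ := by
  intro φ
  -- the restriction `Π^tp_X → Π_X` of `toHat`
  set rX : ↥(T.tp T.PiX) →* ↥T.PiX :=
    (T.toHat.comp (T.tp T.PiX).subtype).codRestrict T.PiX fun x => x.2 with hrX
  apply le_antisymm
  swap
  · exact Subgroup.le_normalizer_map _
  intro a ha
  -- (1) the arithmetic input: `a ∈ Π_X`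
  have hmap : H.map φ = (H.map rX).map j := by rw [Subgroup.map_map]
  rw [hmap] at ha
  obtain ⟨b, rfl⟩ := harith H hH a ha
  -- (2) `b` normalises the image of `H` in `Π_X`
  have hb : b ∈ Subgroup.normalizer ((H.map rX : Subgroup ↥T.PiX) : Set ↥T.PiX) := by
    have h1 : b ∈ (Subgroup.normalizer (((H.map rX).map j : Subgroup PiXF) : Set PiXF)).comap j := ha
    rw [Subgroup.comap_normalizer_eq_of_le_range (Subgroup.map_le_range j _),
      Subgroup.comap_map_eq_self_of_injective hj] at h1
    exact h1
  -- (3) hence `(b : Π_C)` normalises the image of `H' := H ⊆ Π^tp_C` under `toHat`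
  set H' : Subgroup T.Gtp := H.map (T.tp T.PiX).subtype with hH'
  have hHH' : (H.map rX).map T.PiX.subtype = H'.map T.toHat := by
    rw [hH', Subgroup.map_map, Subgroup.map_map]
    congr 1
  have hb' : (b : T.PiC) ∈ Subgroup.normalizer ((H'.map T.toHat : Subgroup T.PiC) : Set T.PiC) := by
    rw [← hHH']
    have h1 : b ∈ (Subgroup.normalizer ((((H.map rX).map T.PiX.subtype) : Subgroup T.PiC) :
        Set T.PiC)).comap T.PiX.subtype := by
      rw [Subgroup.comap_normalizer_eq_of_le_range (Subgroup.map_le_range _ _),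
        Subgroup.comap_map_eq_self_of_injective T.PiX.subtype_injective]
      exact hb
    exact h1
  -- (4) Lemma 2.17 (ii) for the open subgroup `H'` of `Π^tp_C`
  have hopen : IsOpen ((T.tp T.PiX : Subgroup T.Gtp) : Set T.Gtp) :=
    T.isOpen_PiX.preimage T.continuous_toHat
  have hH'open : IsOpen (H' : Set T.Gtp) := by
    rw [hH', Subgroup.coe_map]
    exact hopen.isOpenMap_subtype_val _ hH
  rw [h217ii H' hH'open] at hb'
  obtain ⟨n, hn, hnb⟩ := hb'
  -- (5) `n ∈ Π^tp_X` and it normalises `H` there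
  have hnX : n ∈ T.tp T.PiX := by
    change T.toHat n ∈ T.PiX
    rw [hnb]
    exact b.2
  refine ⟨⟨n, hnX⟩, ?_, ?_⟩
  · have h1 : n ∈ (Subgroup.normalizer ((H' : Subgroup T.Gtp) : Set T.Gtp)) := hn
    have h2 : (⟨n, hnX⟩ : ↥(T.tp T.PiX)) ∈
        (Subgroup.normalizer ((H' : Subgroup T.Gtp) : Set T.Gtp)).comap (T.tp T.PiX).subtype := h1
    rw [hH', Subgroup.comap_normalizer_eq_of_le_range (Subgroup.map_le_range _ _),
      Subgroup.comap_map_eq_self_of_injective (T.tp T.PiX).subtype_injective] at h2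
    exact h2
  · change j (rX ⟨n, hnX⟩) = j b
    congr 1
    exact Subtype.ext hnb

end Literature.AnabelianGeometry.EtaleTheta.ThetaCovers.TemperedCoverData
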